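import Summits.BirchSwinnertonDyer.BirchSwinnertonDyer.Theorems.EisensteinPrimesFullDescentMultiplicativeUnipotentLine
import Summits.BirchSwinnertonDyer.BirchSwinnertonDyer.Theorems.EisensteinPrimesFullDescentTheoremB
import Summits.BirchSwinnertonDyer.BirchSwinnertonDyer.Theorems.EisensteinPrimesFullDescentAssembly
import Summits.BirchSwinnertonDyer.Rank1Residual.X2.GreenbergVatsalStrictSelmerMultiplicative
import Literature.NumberTheory.EllipticCurves.Rank1Residual.Predicates
import Literature.NumberTheory.EllipticCurves.Rank1Residual.AnomalousDictionaryProofs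
import Literature.NumberTheory.EllipticCurves.SelmerCorankControlRatProofs
import HarnessLib

/-!
# Route `EisensteinPrimes`, crux 2 `GoodLatticeBDPValue` (stmt-BirchSwinnertonDyer-19032), line `halves` v21, stub 3a-B
# `stub_fullDescentAtThreeOfRed` (Theorem T′): **the piece `hS` (Lemma S′) of the LEAD's assembly in EXACTLY the assembly's
# shape, and the assembly with `hS` and `hB` discharged — stub 3a-B modulo Theorem A alone**

Cell `bsd-eis`, width seat `bsd-line-x1-p1-w2` (gen 5; `--supports -19032`, closes nothing by itself). The LEAD's assembly
`FullDescentAssembly.fullDescentAtThreeOfRed_of_pieces` (p656167) proves the registered stub 3a-B, token for token, from three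
global hypotheses `hS hB hA`; `hB` (Theorem B) is the tree theorem `FullDescentTheoremB.exists_omega_point_of_fixed_point`
(LEAD gen 5, p656782, on this seat's unconditional Kummer splitting p654936). THIS file discharges `hS`:

* `lemmaS_of_semistable` / `lemmaS_spec` (= `hS` verbatim): for `W/ℚ` globally minimal and semistable, the isogeny character
  `r` of a point `P ≠ 0` of `E[3]` spanning a rational line is `𝟙` or `χ̄₃` — this seat's
  `FullDescentMultiplicativeUnipotentLine.lineCharacter_three_dichotomy_of_good_or_mult` (Lemma S′ with its local unipotence
  input discharged at ALL multiplicative places, p655762) plus the prime/place dictionary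
  (`hasGoodReductionAt_of_hasGoodReductionAtPrime`, `hasMultiplicativeReductionAt_of_mem`);
* `fullDescentAtThreeOfRed_of_theoremA`: the registered statement of stub 3a-B from `hA` ALONE.

HONEST FRAMING: helper theorems only (0 definitions, 0 named facts, 0 sorry). After this file exactly ONE hypothesis of the
assembly is open — `hA` (Theorem A, «Case ω ⇒ ⊥»: LEAD gen 5 A-I + w3 gen 4 A-II); THIS file closes no stub, no crux, no
summit statement, no BSD / IMC / Keller–Yin theorem. References: [SerreInventiones1972] §1.12; [Mazur1978] §5;
[Kriz2016] Thm. 34–35; [SilvermanATAEC1994] V.5.3.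
-/

set_option autoImplicit false
-- the route's Theorems namespace repeats the summit name by design (D-0017 nested layout)
set_option linter.dupNamespace false

noncomputable section

open scoped Classical NumberField

namespace Summit.BirchSwinnertonDyer.BirchSwinnertonDyer.Theorems.FullDescentSpecPieces

open Function NumberField IsDedekindDomain Field Rat.HeightOneSpectrum WeierstrassCurve
  Literature.NumberTheory.GaloisRepresentations Literature.NumberTheory.EllipticCurves
  Literature.NumberTheory.EllipticCurves.Rank1Residual
  Summit.BirchSwinnertonDyer.BirchSwinnertonDyer.Theorems.FullDescentMultiplicativeUnipotentLine

/-! ## §1. `hS`: Lemma S′ for a semistable curve, in the assembly's shape -/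

/-- **Lemma S′ for a semistable curve.** `W/ℚ` globally minimal and semistable (every prime good or multiplicative),
`P ≠ 0` in `E[3]` with `σ P = r(σ) P` for a character `r : Γ_ℚ → (ℤ/3)ˣ`: then `r = 𝟙` or `r = χ̄₃`. (Every place `v ∤ 3`
is good or multiplicative by the prime/place dictionary; then `lineCharacter_three_dichotomy_of_good_or_mult`.)
[cite: SerreInventiones1972, §1.12] [cite: Mazur1978, §5 Lemma 5.2–5.3] -/
theorem lemmaS_of_semistable (W : WeierstrassCurve ℚ) [W.IsElliptic] [W.IsGloballyMinimal]
    (hsemi : Semistable W) {P : geomTorsion W ((3 : ℕ) : ℤ)} (hP0 : P ≠ 0)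
    {r : absoluteGaloisGroup ℚ →* (ZMod 3)ˣ}
    (hr : ∀ σ : absoluteGaloisGroup ℚ, σ • P = ((r σ : (ZMod 3)ˣ) : ZMod 3).val • P) :
    (∀ σ : absoluteGaloisGroup ℚ, r σ = 1) ∨
      (∀ σ : absoluteGaloisGroup ℚ, r σ = modNCyclotomicCharacter ℚ 3 σ) := by
  refine lineCharacter_three_dichotomy_of_good_or_mult W hP0 hr fun v _ ↦ ?_
  haveI hℓ : Fact (primesEquiv v : ℕ).Prime := Fact.mk (primesEquiv v).2
  have hpv : (((primesEquiv v : Nat.Primes) : ℕ) : 𝓞 ℚ) ∈ v.asIdeal := natCast_mem_asIdeal_of_primesEquiv_eq rfl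
  rcases hsemi (primesEquiv v : ℕ) (primesEquiv v).2 with hg | hm
  · exact Or.inl (W.hasGoodReductionAt_of_hasGoodReductionAtPrime v hpv hg)
  · exact Or.inr (Summit.BirchSwinnertonDyer.Rank1Residual.X2.GreenbergVatsalStrictSelmerMultiplicative.hasMultiplicativeReductionAt_of_mem
      W (primesEquiv v : ℕ) hm hpv)

/-- **`hS` of `FullDescentAssembly.fullDescentAtThreeOfRed_of_pieces`, token for token** (the hypothesis «`3` good» of
the assembly's shape is not needed and is discarded). [cite: SerreInventiones1972, §1.12] [cite: Mazur1978, §5] -/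
theorem lemmaS_spec : ∀ (W : WeierstrassCurve ℚ) [W.IsElliptic] [W.IsGloballyMinimal],
    W.HasGoodReductionAtPrime 3 → Semistable W →
    ∀ {P : geomTorsion W ((3 : ℕ) : ℤ)}, P ≠ 0 → ∀ {r : absoluteGaloisGroup ℚ →* (ZMod 3)ˣ},
      (∀ σ : absoluteGaloisGroup ℚ, σ • P = ((r σ : (ZMod 3)ˣ) : ZMod 3).val • P) →
      (∀ σ : absoluteGaloisGroup ℚ, r σ = 1) ∨
        (∀ σ : absoluteGaloisGroup ℚ, r σ = modNCyclotomicCharacter ℚ 3 σ) :=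
  fun W _ _ _ hsemi _ hP0 _ hr ↦ lemmaS_of_semistable W hsemi hP0 hr

/-! ## §2. Stub 3a-B modulo Theorem A -/

/-- **The assembly with `hS` (this file) and `hB` (LEAD gen 5's `FullDescentTheoremB.exists_omega_point_of_fixed_point`,
p656782) discharged**: stub 3a-B (`stub_fullDescentAtThreeOfRed`, verbatim statement) from the single remaining piece `hA`
(Theorem A, «Case ω ⇒ ⊥»). [cite: Kriz2016, Thm. 34 (1)–(3), Thm. 35]
[cite: SerreInventiones1972, §1.11 Prop. 12] [cite: Mazur1978, §5 (pp. 148–152)] -/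
theorem fullDescentAtThreeOfRed_of_theoremA
    (hA : ∀ (W : WeierstrassCurve ℚ) [W.IsElliptic] [W.IsGloballyMinimal],
      W.HasGoodReductionAtPrime 3 → ¬ (3 : ℤ) ∣ W.frobeniusTrace 3 →
      (∀ v : HeightOneSpectrum (𝓞 ℚ), natGenerator v ≠ 3 →
        W.HasGoodReductionAt v ∨ (W.HasSplitMultiplicativeReductionAt v ∧ natGenerator v % 3 = 2)) →
      ∀ Q : geomTorsion W ((3 : ℕ) : ℤ), Q ≠ 0 →
        (∀ σ : absoluteGaloisGroup ℚ, σ • Q = ((modNCyclotomicCharacter ℚ 3 σ : (ZMod 3)ˣ) : ZMod 3).val • Q) →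
        False) :
    ∀ (W : WeierstrassCurve ℚ) [W.IsElliptic] [W.IsGloballyMinimal] (p : ℕ) [Fact p.Prime],
      p = 3 → Good W p → Red W p →
      ((∃ (ℓ : ℕ) (hℓ : ℓ.Prime), haveI : Fact ℓ.Prime := ⟨hℓ⟩; Addv W ℓ) ∨
        (∃ (ℓ : ℕ) (hℓ : ℓ.Prime), haveI : Fact ℓ.Prime := ⟨hℓ⟩;
          W.HasMultiplicativeReductionAtPrime ℓ ∧
            ((W.HasSplitMultiplicativeReductionAtPrime ℓ ∧ ℓ ≡ 1 [MOD p]) ∨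
              (¬ W.HasSplitMultiplicativeReductionAtPrime ℓ ∧ ℓ + 1 ≡ 0 [MOD p])))) :=
  Summit.BirchSwinnertonDyer.BirchSwinnertonDyer.Theorems.FullDescentAssembly.fullDescentAtThreeOfRed_of_pieces
    lemmaS_spec Summit.BirchSwinnertonDyer.BirchSwinnertonDyer.Theorems.FullDescentTheoremB.exists_omega_point_of_fixed_point hA

end Summit.BirchSwinnertonDyer.BirchSwinnertonDyer.Theorems.FullDescentSpecPieces

end
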